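import Literature.Probability.RandomPlanarGeometry.SLENotSimplePath
import Literature.Probability.RandomPlanarGeometry.LoewnerArcConfinement
import Literature.Probability.RandomPlanarGeometry.LoewnerDescriptionProofs
import Literature.Probability.RandomPlanarGeometry.SLEStoppedCurveEvents
import Summits.CriticalPhenomena.SAWScalingLimit.Theorems.ObservableToSLE.Negative.ChordalCarrier
import Summits.CriticalPhenomena.SAWScalingLimit.Theorems.SAWWeldingIdentificationRemovableLimitOfSLELaw
import Summits.CriticalPhenomena.SAWScalingLimit.Theorems.SAWWeldingIdentificationRemovableLimitS1IsSimpleSubseqLimits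
import HarnessLib

/-!
# Crux `RemovableLimit` (stmt-CriticalPhenomena-4503) up to `κ`: the `κ`-pin from simplicity and
# the reduction (R) ⟸ "some SLE_κ law" ∧ `SimpleSubseqLimits`

Route `SAWWeldingIdentification`, crux (R) `RemovableLimit`, line `registered`, skeleton v4
(`Cruxes/RemovableLimit/Lines/registered.lean`). Skeleton v3 had reduced (R) to the single stub
"every subsequential SAW limit is THE chordal SLE₈/₃ law" (≡ stmt-0783 ⟸ stmt-4502). This file
shows that (R) never needed the VALUE `κ = 8/3`:

* **`stub_kappaPin`** = `kappa_le_four_of_isSLELaw_of_ae_mem_simple` (registered stub T4 of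
  skeleton v4, proved here): a chordal SLE_κ law carried by simple curve classes has `κ ≤ 4` — the
  law-level contrapositive of "for `κ > 4` the SLE trace is a.s. not a simple path" (Rohde–Schramm
  2005 §1 p. 885 / Schramm 2000; tree theorem `ae_not_injective_sleTrace_of_four_lt`), transported
  through the compactified image of the trace by the deterministic lemma
  `injective_of_isFlat_compactifiedImage` (flat image ⟹ injective trace: boundary correspondence
  injective on the closed half-plane, hulls strictly growing) and the flatness of representatives
  of simple classes (`isFlat_of_mk_mem_simple`). With RS05 Thm 6.1 this is the dichotomy
  `ae_mem_simple_iff_le_four`.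
* **`ae_isConformallyRemovableIn_of_isSLELaw_of_ae_mem_simple`**: an SLE_κ law (`0 < κ`, `κ ≠ 4`)
  carried by simple classes is carried by classes with conformally removable trace (pin `κ ≤ 4`,
  so `κ < 4`, then the landed transfer `ae_isConformallyRemovableIn_of_isSLELaw`, RS05 Thm 5.2 +
  Jones–Smirnov through the analytic bad set, p151121).
* **`removableLimit_of_upToKappa_of_simpleSubseqLimits`** — THE v4 COMPOSITION at item level:
  (R) follows from S0a "every subsequential SAW limit in `(Q; a_δ, b_δ)` is a chordal SLE_κ law in
  `Q.chord 0 2` for SOME `κ > 0`, `κ ≠ 4`" together with the sibling crux `SimpleSubseqLimits`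
  (stmt-CriticalPhenomena-4982, necessary for (R) anyway, p143725).
* **`removableLimit_of_sleSubseqLimitLtFour`** — single-input variant: (R) follows from "every
  subsequential SAW limit is an SLE_κ law for some `0 < κ < 4`" alone
  (`ae_removableSimpleChord_of_isSLELaw_of_lt_four`, the `κ`-generic form of p151121's
  `ae_removableSimpleChord_of_isSLELaw`).
* **`removableLimit_of_someSLELaw_of_simpleSubseqLimits_of_sleFourRemovable`** — the variant
  WITHOUT the side condition `κ ≠ 4`, at the price of the in-domain removability of SLE₄
  (Kavvadias–Miller–Schoug, *Conformal removability of SLE₄*, arXiv:2209.10532, Thm 1.1, plus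
  Jones–Smirnov p. 264 domain independence; taken as an explicit hypothesis, not in the tree):
  then S0a is literally implied by the dock stub `stub_identificationUpToKappa` of the stmt-0783
  chain (`someSLELaw_of_identificationUpToKappa`).
* Links: `sleSubseqLimitUpToKappa_of_subseqIdentification` (stmt-0783 ⟹ S0a),
  `sleSubseqLimitUpToKappa_of_weldingLawOfLimit` (stmt-4502 ⟹ S0a).

Kernel-exact position of (R) (all tree theorems with this file):
`summit ⟹ stmt-0783 ⟺ stmt-4502 ⟹ S0a`, `stmt-0783 ⟹ (R) ⟹ stmt-4982`, `S0a ∧ stmt-4982 ⟹ (R)`.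

## References

[RohdeSchramm2005] §1 p. 885–886, Thm 5.2, Thm 6.1; [JonesSmirnov2000] Def. 1, Cor. 2, p. 264;
[Lawler2005] Thm 4.6, §6.3; Kavvadias–Miller–Schoug, arXiv:2209.10532, Thm 1.1;
[LawlerSchrammWerner2004SAW] §3.4.2.
-/

noncomputable section

open MeasureTheory Filter Set Metric
open scoped Topology NNReal unitInterval
open Literature.Probability.RandomPlanarGeometry Literature.Probability.LatticeModels
open Literature.Probability.Process (preWienerMeasure)
open Summit.CriticalPhenomena.SAWScalingLimit.Theses

namespace Summit.CriticalPhenomena.SAWScalingLimit.Theorems.RemovableLimit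

/-! ### 1. The `κ`-pin from simplicity -/

/-- **Deterministic core of the `κ`-pin: a flat compactified image forces an injective trace.**
Let `γ` be the generating curve of the Loewner chain of a continuous driving function `W`,
`φ : ℍ → D` a conformal map onto a Jordan domain and `c` the time-compactified image of `γ` under
the boundary extension `Φ` of `φ` (`c s = Φ (γ (s/(1-s)))` for `s < 1`). If `c` is flat (equal
values at `s ≤ t` only if constant on `[s, t]`) then `γ` is injective: a coincidence
`γ t₁ = γ t₂`, `t₁ < t₂`, gives `c s₁ = c s₂` at the parameters `sᵢ < 1` over `tᵢ`, so `c` is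
constant on `[s₁, s₂]`, so `Φ ∘ γ` is constant on `[t₁, t₂]` (every `t` there is `rayParam u`,
`u ∈ [s₁, s₂]`), so `γ` is constant on `[t₁, t₂]` (`Φ` is injective on the closed half-plane,
`JordanDomain.injOn_boundaryExtension`, which contains the trace) — contradicting the strict
growth of the hulls ("no stalling", `Loewner.IsGeneratedByCurve.not_image_Icc_subset`).
[folklore] -/
theorem injective_of_isFlat_compactifiedImage {W : ℝ≥0 → ℝ} {γ : ℝ≥0 → ℂ} (hW : Continuous W)
    (hγ : Loewner.IsGeneratedByCurve W γ) {D : JordanDomain}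
    (φ : ConformalEquiv UpperHalfPlane.upperHalfPlaneSet D.carrier) {b : ℂ} {c : Curve ℂ}
    (hc : IsCompactifiedImage φ.boundaryExtension γ b c) (hflat : c.IsFlat) :
    Function.Injective γ := by
  -- it suffices to exclude coincidences `γ t₁ = γ t₂` with `t₁ < t₂`
  suffices key : ∀ ⦃t₁ t₂ : ℝ≥0⦄, t₁ < t₂ → γ t₁ = γ t₂ → False by
    intro t₁ t₂ h
    rcases lt_trichotomy t₁ t₂ with hlt | heq | hgt
    · exact (key hlt h).elim
    · exact heq
    · exact (key hgt h.symm).elim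
  intro t₁ t₂ hlt heq
  have hinj := JordanDomain.injOn_boundaryExtension φ
  -- parameters over `t₁`, `t₂`
  obtain ⟨s₁, hs₁, rfl⟩ := exists_rayParam_eq t₁
  obtain ⟨s₂, hs₂, rfl⟩ := exists_rayParam_eq t₂
  have hcs : c s₁ = c s₂ := by rw [hc.1 s₁ hs₁, hc.1 s₂ hs₂, heq]
  -- `c` is constant on `[s₁, s₂]`, hence `γ` is constant on `[rayParam s₁, rayParam s₂]`
  refine hγ.not_image_Icc_subset hW hlt ?_
  rintro _ ⟨t, ht, rfl⟩
  obtain ⟨u, hu, rfl⟩ := exists_rayParam_eq t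
  have hsu : s₁ ≤ u := (rayParam_le_rayParam_iff hs₁ hu).1 ht.1
  have hus : u ≤ s₂ := (rayParam_le_rayParam_iff hu hs₂).1 ht.2
  have hcu : c u = c s₁ := hflat s₁ u s₂ hsu hus hcs
  rw [hc.1 u hu, hc.1 s₁ hs₁] at hcu
  have hγu : γ (rayParam u) = γ (rayParam s₁) :=
    hinj (hγ.im_nonneg _) (hγ.im_nonneg _) hcu
  rw [hγu]
  exact mem_image_of_mem γ ⟨zero_le, le_rfl⟩

/-- **The `κ`-pin: an SLE_κ law charging simple curves has `κ ≤ 4`.** If `μ` is a chordal SLE_κ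
law in the Dobrushin domain `(D; a, b)` and `μ`-almost every curve class is simple, then `κ ≤ 4`.
For `κ > 4` the SLE_κ trace is almost surely NOT injective (Rohde–Schramm 2005, §1 p. 885;
Schramm 2000; tree theorem `ae_not_injective_sleTrace_of_four_lt`), while a.s. simplicity of the
class of its compactified image in `D` (pulled back from the law through the Borel event
`CurveClass.simple`) makes that image flat (`isFlat_of_mk_mem_simple`) and hence the trace
injective (`injective_of_isFlat_compactifiedImage`); the two almost-sure statements are
incompatible on a probability space. Law-level converse of `IsSLELaw.ae_simple` (RS05 Thm. 6.1).
[cite: RohdeSchramm2005, §1 p. 885–886] -/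
theorem kappa_le_four_of_isSLELaw_of_ae_mem_simple {κ : ℝ≥0} {D : DobrushinDomain}
    {μ : Measure (CurveClass ℂ)} (h : IsSLELaw κ D μ)
    (hs : ∀ᵐ γ ∂μ, γ ∈ (CurveClass.simple : Set (CurveClass ℂ))) : κ ≤ 4 := by
  by_contra hκ
  have hκ' : 4 < κ := not_le.1 hκ
  obtain ⟨Γ, ⟨hΓm, φ, -, hae⟩, rfl⟩ := h
  haveI : IsProbabilityMeasure preWienerMeasure := isProbabilityMeasure_preWienerMeasure'
  have hs' : ∀ᵐ ω ∂preWienerMeasure, Γ ω ∈ (CurveClass.simple : Set (CurveClass ℂ)) :=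
    (ae_map_iff hΓm (show MeasurableSet {γ : CurveClass ℂ | γ ∈ CurveClass.simple} from
      CurveClass.measurableSet_simple')).1 hs
  have hfalse : ∀ᵐ ω ∂preWienerMeasure, False := by
    filter_upwards [hae, hs', ae_not_injective_sleTrace_of_four_lt hκ'] with ω hω hsω hninj
    obtain ⟨hgen, c, hΓω, hc⟩ := hω
    rw [hΓω] at hsω
    exact hninj (injective_of_isFlat_compactifiedImage (continuous_sleDriving κ ω) hgen φ hc
      (ObservableToSLE.Negative.isFlat_of_mk_mem_simple hsω))
  have h0 : preWienerMeasure = 0 := ae_eq_bot.1 (eventually_false_iff_eq_bot.1 hfalse)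
  exact IsProbabilityMeasure.ne_zero preWienerMeasure h0

/-- **T4 `stub_kappaPin` of skeleton v4 of crux stmt-CriticalPhenomena-4503, by name and
signature**: a chordal SLE_κ law in a Dobrushin domain that is carried by simple curve classes has
`κ ≤ 4` (`kappa_le_four_of_isSLELaw_of_ae_mem_simple`). [cite: RohdeSchramm2005, §1 p. 885–886] -/
theorem stub_kappaPin :
    ∀ (κ : ℝ≥0) (D : DobrushinDomain) (μ : Measure (CurveClass ℂ)), IsSLELaw κ D μ →
    (∀ᵐ γ ∂μ, γ ∈ CurveClass.simple) → κ ≤ 4 :=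
  fun _ _ _ h hs => kappa_le_four_of_isSLELaw_of_ae_mem_simple h hs

/-- **Simple-phase dichotomy for SLE laws**: a chordal SLE_κ law (`0 < κ`) in `D` is carried by
simple curve classes iff `κ ≤ 4` (`⇐`: Rohde–Schramm Thm. 6.1 via `IsSLELaw.ae_simple`; `⇒`:
`kappa_le_four_of_isSLELaw_of_ae_mem_simple`). [cite: RohdeSchramm2005, §1 p. 886 and Thm. 6.1] -/
theorem ae_mem_simple_iff_le_four {κ : ℝ≥0} {D : DobrushinDomain} {μ : Measure (CurveClass ℂ)}
    (h0 : 0 < κ) (h : IsSLELaw κ D μ) :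
    (∀ᵐ γ ∂μ, γ ∈ (CurveClass.simple : Set (CurveClass ℂ))) ↔ κ ≤ 4 :=
  ⟨kappa_le_four_of_isSLELaw_of_ae_mem_simple h, fun h4 =>
    (h.ae_simple ae_isSimpleTrace_sleTrace_of_le_four_holds CurveClass.measurableSet_simple_holds
      h0 h4).mono fun _ hγ => hγ.1⟩

/-! ### 2. Removability of simple-phase SLE laws -/

/-- **An SLE_κ law (`0 < κ`, `κ ≠ 4`) carried by simple classes is carried by classes with
conformally removable trace**: the pin gives `κ ≤ 4`, so `κ < 4`, and the transfer
`ae_isConformallyRemovableIn_of_isSLELaw` (Rohde–Schramm Thm 5.2 Hölder domains + Jones–Smirnov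
Cor. 2, pushed to the law through the analytic bad set) applies. [folklore] -/
theorem ae_isConformallyRemovableIn_of_isSLELaw_of_ae_mem_simple {κ : ℝ≥0} (h0 : 0 < κ)
    (h4 : κ ≠ 4) {D : DobrushinDomain} {P : Measure (CurveClass ℂ)} (h : IsSLELaw κ D P)
    (hs : ∀ᵐ γ ∂P, γ ∈ (CurveClass.simple : Set (CurveClass ℂ))) :
    ∀ᵐ γ ∂P, IsConformallyRemovableIn D.carrier γ.range :=
  ae_isConformallyRemovableIn_of_isSLELaw h0
    (lt_of_le_of_ne (kappa_le_four_of_isSLELaw_of_ae_mem_simple h hs) h4) h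

/-- **A simple-phase SLE_κ law (`0 < κ < 4`) in `Q.chord 0 2` is carried by removable simple
chords of `(Q.carrier; Q.pt 0, Q.pt 2)`** — the conclusion of the crux `RemovableLimit` for such a
law, verbatim (the `κ`-generic form of `ae_removableSimpleChord_of_isSLELaw`): simplicity and
boundary avoidance by `IsSLELaw.ae_simple` (RS05 Thm 6.1), endpoints and closure by
`IsSLELaw.ae_endpoints` (Carathéodory), removability by `ae_isConformallyRemovableIn_of_isSLELaw`
in the self-map clause (`IsConformallyRemovableIn.self_maps`). [folklore] -/
theorem ae_removableSimpleChord_of_isSLELaw_of_lt_four (Q : ConformalRectangle) {κ : ℝ≥0}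
    (h0 : 0 < κ) (h4 : κ < 4) {P : Measure (CurveClass ℂ)}
    (h : IsSLELaw κ (Q.chord 0 2 (by decide)) P) :
    ∀ᵐ γ ∂P, (γ ∈ CurveClass.simple ∧ γ.source = Q.pt 0 ∧ γ.target = Q.pt 2 ∧
        γ.range ⊆ closure Q.carrier ∧ γ.range ∩ frontier Q.carrier ⊆ {Q.pt 0, Q.pt 2}) ∧
      (∀ F : ℂ → ℂ, ContinuousOn F Q.carrier → Set.InjOn F Q.carrier → F '' Q.carrier = Q.carrier →
        DifferentiableOn ℂ F (Q.carrier \ γ.range) → DifferentiableOn ℂ F Q.carrier) := by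
  have h1 := h.ae_simple ae_isSimpleTrace_sleTrace_of_le_four_holds
    CurveClass.measurableSet_simple_holds h0 h4.le
  have h2 := h.ae_endpoints JordanDomain.mapsTo_boundaryExtension_holds
  have h3 := ae_isConformallyRemovableIn_of_isSLELaw h0 h4 h
  filter_upwards [h1, h2, h3] with γ h1 h2 h3
  exact ⟨⟨h1.1, h2.1, h2.2.1, h2.2.2, h1.2⟩, h3.self_maps⟩

/-! ### 3. The crux from identification UP TO `κ` -/

/-- **(R) ⟸ "every subsequential SAW limit is a simple-phase SLE law"** (single-input variant of
skeleton v4): if for every conformal rectangle `Q`, endpoint approximation and subsequential weak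
limit `P` of the critical SAW laws in `(Q; a_δ, b_δ)` there is `κ ∈ (0, 4)` with `P` a chordal
SLE_κ law in `Q.chord 0 2`, then `RemovableLimit` holds
(`ae_removableSimpleChord_of_isSLELaw_of_lt_four`). Strictly weaker input than the v3 stub
(`κ = 8/3`, i.e. stmt-0783 framed on `Q.chord 0 2`). [folklore] -/
theorem removableLimit_of_sleSubseqLimitLtFour
    (h : ∀ (Q : ConformalRectangle) (a b : ℝ → Site 2),
      SAW.IsEndpointApprox (Q.chord 0 2 (by decide)) a b →
      ∀ (P : Measure (CurveClass ℂ)), IsProbabilityMeasure P → ∀ (δs : ℕ → ℝ), (∀ n, 0 < δs n) →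
      Tendsto δs atTop (𝓝 0) →
      (∀ f : BoundedContinuousFunction (CurveClass ℂ) ℝ,
        Tendsto (fun n => ∫ γ, f γ.curve ∂(SAW.law Q.carrier (δs n) (a (δs n)) (b (δs n)))) atTop
          (𝓝 (∫ γ, f γ ∂P))) →
      ∃ κ : ℝ≥0, 0 < κ ∧ κ < 4 ∧ IsSLELaw κ (Q.chord 0 2 (by decide)) P) :
    SAWWeldingIdentification.RemovableLimit := by
  intro Q a b hab P hP δs hpos hδ hlim
  obtain ⟨κ, h0, h4, hSLE⟩ := h Q a b hab P hP δs hpos hδ hlim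
  exact ae_removableSimpleChord_of_isSLELaw_of_lt_four Q h0 h4 hSLE

/-- **THE v4 COMPOSITION — (R) ⟸ S0a ∧ stmt-4982.** If (S0a) every subsequential weak limit `P` of
the critical SAW laws in `(Q; a_δ, b_δ)` is a chordal SLE_κ law in `Q.chord 0 2` for SOME `κ > 0`,
`κ ≠ 4`, and (S1 = `SimpleSubseqLimits`, stmt-CriticalPhenomena-4982) every subsequential weak
limit is carried by simple chords, then `RemovableLimit` (stmt-CriticalPhenomena-4503) holds: S1
gives the simple-chord half and `P`-a.e. simplicity (`stub_of_simpleSubseqLimits`, p143725), which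
pins `κ < 4` (`kappa_le_four_of_isSLELaw_of_ae_mem_simple`), and the transfer gives `P`-a.e.
removability (`ae_isConformallyRemovableIn_of_isSLELaw_of_ae_mem_simple`), delivered in the
self-map clause of the crux. [folklore] -/
theorem removableLimit_of_upToKappa_of_simpleSubseqLimits
    (h0a : ∀ (Q : ConformalRectangle) (a b : ℝ → Site 2),
      SAW.IsEndpointApprox (Q.chord 0 2 (by decide)) a b →
      ∀ (P : Measure (CurveClass ℂ)), IsProbabilityMeasure P → ∀ (δs : ℕ → ℝ), (∀ n, 0 < δs n) →
      Tendsto δs atTop (𝓝 0) →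
      (∀ f : BoundedContinuousFunction (CurveClass ℂ) ℝ,
        Tendsto (fun n => ∫ γ, f γ.curve ∂(SAW.law Q.carrier (δs n) (a (δs n)) (b (δs n)))) atTop
          (𝓝 (∫ γ, f γ ∂P))) →
      ∃ κ : ℝ≥0, 0 < κ ∧ κ ≠ 4 ∧ IsSLELaw κ (Q.chord 0 2 (by decide)) P)
    (h1 : SAWLoopFugacityFlow.SimpleSubseqLimits) :
    SAWWeldingIdentification.RemovableLimit := by
  intro Q a b hab P hP δs hpos hδ hlim
  have hsc := stub_of_simpleSubseqLimits h1 Q a b hab P hP δs hpos hδ hlim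
  obtain ⟨κ, hκ0, hκ4, hSLE⟩ := h0a Q a b hab P hP δs hpos hδ hlim
  have hrem := ae_isConformallyRemovableIn_of_isSLELaw_of_ae_mem_simple hκ0 hκ4 hSLE
    (hsc.mono fun γ hγ => hγ.1)
  filter_upwards [hsc, hrem] with γ h1γ h2γ
  exact ⟨h1γ, h2γ.self_maps⟩

/-! ### 4. The variant through the removability of SLE₄ (Kavvadias–Miller–Schoug) -/

/-- **Removability of SLE₄ laws from the almost-sure statement.** IF almost surely (in the
driving Brownian path) every chordal SLE₄ random curve in a Dobrushin domain `D` has conformally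
removable trace inside `D.carrier` (hypothesis `h3`: the in-domain form of Kavvadias–Miller–Schoug,
*Conformal removability of SLE₄*, arXiv:2209.10532, Thm 1.1, with Jones–Smirnov p. 264 domain
independence and locality — NOT in the tree, taken as a hypothesis), then every chordal SLE₄ LAW
is carried by classes with removable trace: the bad set is analytic
(`analyticSet_setOf_not_isConformallyRemovableIn`) and a.s. avoided, hence null for the law
(`ae_map_notMem_of_analyticSet`). [folklore] -/
theorem ae_isConformallyRemovableIn_of_isSLELaw_four
    (h3 : ∀ (D : DobrushinDomain) (Γ : (ℝ≥0 → ℝ) → CurveClass ℂ), IsSLECurve 4 D Γ →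
      ∀ᵐ ω ∂preWienerMeasure, IsConformallyRemovableIn D.carrier (Γ ω).range)
    {D : DobrushinDomain} {P : Measure (CurveClass ℂ)} (h : IsSLELaw 4 D P) :
    ∀ᵐ γ ∂P, IsConformallyRemovableIn D.carrier γ.range := by
  obtain ⟨Γ, hΓ, rfl⟩ := h
  haveI : IsProbabilityMeasure preWienerMeasure := isProbabilityMeasure_preWienerMeasure'
  have hbad := ae_map_notMem_of_analyticSet hΓ.1
    (analyticSet_setOf_not_isConformallyRemovableIn D.isOpen)
    ((h3 D Γ hΓ).mono fun ω hω => by simpa using hω)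
  exact hbad.mono fun γ hγ => by simpa using hγ

/-- **(R) ⟸ "some SLE_κ law" ∧ stmt-4982 ∧ SLE₄-removability.** The v4 composition WITHOUT the
side condition `κ ≠ 4` in the identification input: if every subsequential weak limit `P` in
`(Q; a_δ, b_δ)` is a chordal SLE_κ law in `Q.chord 0 2` for some `κ > 0` (`h0`), every
subsequential limit is carried by simple chords (`SimpleSubseqLimits`, stmt-4982), and chordal SLE₄
curves have a.s. removable trace inside the domain (`h3`, Kavvadias–Miller–Schoug 2022 Thm 1.1 in
the in-domain form; hypothesis), then `RemovableLimit` holds: the pin gives `κ ≤ 4`; for `κ < 4`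
Rohde–Schramm + Jones–Smirnov, for `κ = 4` the hypothesis `h3`
(`ae_isConformallyRemovableIn_of_isSLELaw_four`). [folklore] -/
theorem removableLimit_of_someSLELaw_of_simpleSubseqLimits_of_sleFourRemovable
    (h0 : ∀ (Q : ConformalRectangle) (a b : ℝ → Site 2),
      SAW.IsEndpointApprox (Q.chord 0 2 (by decide)) a b →
      ∀ (P : Measure (CurveClass ℂ)), IsProbabilityMeasure P → ∀ (δs : ℕ → ℝ), (∀ n, 0 < δs n) →
      Tendsto δs atTop (𝓝 0) →
      (∀ f : BoundedContinuousFunction (CurveClass ℂ) ℝ,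
        Tendsto (fun n => ∫ γ, f γ.curve ∂(SAW.law Q.carrier (δs n) (a (δs n)) (b (δs n)))) atTop
          (𝓝 (∫ γ, f γ ∂P))) →
      ∃ κ : ℝ≥0, 0 < κ ∧ IsSLELaw κ (Q.chord 0 2 (by decide)) P)
    (h1 : SAWLoopFugacityFlow.SimpleSubseqLimits)
    (h3 : ∀ (D : DobrushinDomain) (Γ : (ℝ≥0 → ℝ) → CurveClass ℂ), IsSLECurve 4 D Γ →
      ∀ᵐ ω ∂preWienerMeasure, IsConformallyRemovableIn D.carrier (Γ ω).range) :
    SAWWeldingIdentification.RemovableLimit := by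
  intro Q a b hab P hP δs hpos hδ hlim
  have hsc := stub_of_simpleSubseqLimits h1 Q a b hab P hP δs hpos hδ hlim
  obtain ⟨κ, hκ0, hSLE⟩ := h0 Q a b hab P hP δs hpos hδ hlim
  have hle : κ ≤ 4 := kappa_le_four_of_isSLELaw_of_ae_mem_simple hSLE (hsc.mono fun γ hγ => hγ.1)
  have hrem : ∀ᵐ γ ∂P, IsConformallyRemovableIn (Q.chord 0 2 (by decide)).carrier γ.range := by
    rcases hle.lt_or_eq with hlt | heq
    · exact ae_isConformallyRemovableIn_of_isSLELaw hκ0 hlt hSLE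
    · subst heq
      exact ae_isConformallyRemovableIn_of_isSLELaw_four h3 hSLE
  filter_upwards [hsc, hrem] with γ h1γ h2γ
  exact ⟨h1γ, h2γ.self_maps⟩

/-- **The stmt-0783 dock stub gives "some SLE_κ law" on every `Q.chord 0 2`.** The registered dock
stub `stub_identificationUpToKappa` of the stmt-CriticalPhenomena-0783 chain (line
`boundary-area-law`: along every mesh sequence `s_n → 0⁺` there is ONE `κ > 0` identifying every
subsequential limit in every Dobrushin domain as a chordal SLE_κ law), quoted verbatim as the
hypothesis, implies the identification input `h0` of
`removableLimit_of_someSLELaw_of_simpleSubseqLimits_of_sleFourRemovable` (specialise to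
`s = δs`, `D = Q.chord 0 2`). [folklore] -/
theorem someSLELaw_of_identificationUpToKappa
    (h : ∀ (s : ℕ → ℝ), Tendsto s atTop (𝓝[>] (0 : ℝ)) → ∃ κ : ℝ≥0, 0 < κ ∧
      ∀ (D : DobrushinDomain) (a b : ℝ → Site 2), SAW.IsEndpointApprox D a b →
      ∀ (μ : Measure (CurveClass ℂ)), IsProbabilityMeasure μ →
      (∀ f : BoundedContinuousFunction (CurveClass ℂ) ℝ,
        Tendsto (fun n => ∫ γ, f γ.curve ∂(SAW.law D.carrier (s n) (a (s n)) (b (s n)))) atTop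
          (𝓝 (∫ x, f x ∂μ))) →
      IsSLELaw κ D μ) :
    ∀ (Q : ConformalRectangle) (a b : ℝ → Site 2),
      SAW.IsEndpointApprox (Q.chord 0 2 (by decide)) a b →
      ∀ (P : Measure (CurveClass ℂ)), IsProbabilityMeasure P → ∀ (δs : ℕ → ℝ), (∀ n, 0 < δs n) →
      Tendsto δs atTop (𝓝 0) →
      (∀ f : BoundedContinuousFunction (CurveClass ℂ) ℝ,
        Tendsto (fun n => ∫ γ, f γ.curve ∂(SAW.law Q.carrier (δs n) (a (δs n)) (b (δs n)))) atTop
          (𝓝 (∫ γ, f γ ∂P))) →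
      ∃ κ : ℝ≥0, 0 < κ ∧ IsSLELaw κ (Q.chord 0 2 (by decide)) P := by
  intro Q a b hab P hP δs hpos hδ hlim
  have hδ' : Tendsto δs atTop (𝓝[>] (0 : ℝ)) :=
    tendsto_nhdsWithin_iff.2 ⟨hδ, Eventually.of_forall hpos⟩
  obtain ⟨κ, hκ0, hall⟩ := h δs hδ'
  exact ⟨κ, hκ0, hall (Q.chord 0 2 (by decide)) a b hab P hP hlim⟩

/-! ### 5. S0a from the identification cruxes -/

/-- **stmt-0783 ⟹ S0a**: under `SubseqIdentification` every subsequential limit in `(Q; a_δ, b_δ)`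
is the SLE₈/₃ law in `Q.chord 0 2`, and `8/3 ≠ 4`. [folklore] -/
theorem sleSubseqLimitUpToKappa_of_subseqIdentification
    (hI : SAWLoopFugacityFlow.SubseqIdentification) :
    ∀ (Q : ConformalRectangle) (a b : ℝ → Site 2),
      SAW.IsEndpointApprox (Q.chord 0 2 (by decide)) a b →
      ∀ (P : Measure (CurveClass ℂ)), IsProbabilityMeasure P → ∀ (δs : ℕ → ℝ), (∀ n, 0 < δs n) →
      Tendsto δs atTop (𝓝 0) →
      (∀ f : BoundedContinuousFunction (CurveClass ℂ) ℝ,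
        Tendsto (fun n => ∫ γ, f γ.curve ∂(SAW.law Q.carrier (δs n) (a (δs n)) (b (δs n)))) atTop
          (𝓝 (∫ γ, f γ ∂P))) →
      ∃ κ : ℝ≥0, 0 < κ ∧ κ ≠ 4 ∧ IsSLELaw κ (Q.chord 0 2 (by decide)) P := by
  intro Q a b hab P hP δs hpos hδ hlim
  have hδ' : Tendsto δs atTop (𝓝[>] (0 : ℝ)) :=
    tendsto_nhdsWithin_iff.2 ⟨hδ, Eventually.of_forall hpos⟩
  refine ⟨(8 : ℝ≥0) / 3, by positivity, ?_, hI (Q.chord 0 2 (by decide)) a b hab δs P hδ' hP hlim⟩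
  rw [Ne, div_eq_iff (by norm_num : (3 : ℝ≥0) ≠ 0)]
  norm_num

/-- **stmt-4502 ⟹ S0a**: under this route's crux `WeldingLawOfLimit` every subsequential limit in
`(Q; a_δ, b_δ)` is the SLE₈/₃ law in `Q.chord 0 2` (`isSLELaw_of_weldingLawOfLimit`, p145305), and
`8/3 ≠ 4`. [folklore] -/
theorem sleSubseqLimitUpToKappa_of_weldingLawOfLimit
    (hW : SAWWeldingIdentification.WeldingLawOfLimit) :
    ∀ (Q : ConformalRectangle) (a b : ℝ → Site 2),
      SAW.IsEndpointApprox (Q.chord 0 2 (by decide)) a b →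
      ∀ (P : Measure (CurveClass ℂ)), IsProbabilityMeasure P → ∀ (δs : ℕ → ℝ), (∀ n, 0 < δs n) →
      Tendsto δs atTop (𝓝 0) →
      (∀ f : BoundedContinuousFunction (CurveClass ℂ) ℝ,
        Tendsto (fun n => ∫ γ, f γ.curve ∂(SAW.law Q.carrier (δs n) (a (δs n)) (b (δs n)))) atTop
          (𝓝 (∫ γ, f γ ∂P))) →
      ∃ κ : ℝ≥0, 0 < κ ∧ κ ≠ 4 ∧ IsSLELaw κ (Q.chord 0 2 (by decide)) P := by
  intro Q a b hab P hP δs hpos hδ hlim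
  refine ⟨(8 : ℝ≥0) / 3, by positivity, ?_,
    isSLELaw_of_weldingLawOfLimit hW Q a b hab P hP δs hpos hδ hlim⟩
  rw [Ne, div_eq_iff (by norm_num : (3 : ℝ≥0) ≠ 0)]
  norm_num

end Summit.CriticalPhenomena.SAWScalingLimit.Theorems.RemovableLimit

end
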